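import Summits.Langlands.Langlands.Theorems.IrreducibilityBySelfDualityGaloisRepOfRegularAlgebraicOfWeilTraces
import HarnessLib

/-!
# `GaloisRepOfRegularAlgebraicOfLeaves` (route `IrreducibilityBySelfDuality`, item stmt-Langlands-15026), proved

The glue item of the route-choice RE-ROUTE (2026-08-16) of the crux `GaloisRepOfRegularAlgebraic`
(stmt-Langlands-10785, lang.S27 verbatim) around Varma's Cor. 9.3:

  `HLTTCor627SplitOrUnramified → ACStrongLiftingArchimedean → ACStrongCuspidalBaseChangePrime →
     VarmaWeilTracesUnramified → GaloisRepOfRegularAlgebraic`,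

i.e. the parent crux follows from its four finest leaves — Harris–Lan–Taylor–Thorne 2016 Cor. 6.27
(stmt-Langlands-15020), the archimedean clause of Arthur–Clozel's strong lifting (stmt-Langlands-15021),
Arthur–Clozel's strong cuspidal base change in prime degree (stmt-Langlands-15022) and the trace form of
Varma's Theorem 1 at unramified places in non-zero degree (stmt-Langlands-15004).

## Frame form — why this file does NOT import the route module

When an item closes, the gate links `theorem <Decl>_holds : <Decl> := _root_.<closing theorem>` INTO the
route file, importing the closing module there; a closing module that itself imports the route module is an
import cycle (cf. `Theorems/IrreducibilityBySelfDualityAdjointLiftFromRegularTwist.lean`).  So the closing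
theorem `Summit.Langlands.Langlands.Theorems.GaloisRepOfRegularAlgebraicOfLeaves_proof` below is stated with
the FIVE route decl bodies INLINED VERBATIM (the four leaf item signatures as antecedents, the crux body as
conclusion): its type `δ`-unfolds (five route constants) to the route decl
`Summit.Langlands.Langlands.Theses.IrreducibilityBySelfDuality.GaloisRepOfRegularAlgebraicOfLeaves`, and the
route file can import this module without a cycle (imports: the structural module
`…GaloisRepOfRegularAlgebraicOfWeilTraces` — Literature, `HarnessLib` and landed stub modules only).

## Proof

One line: the landed, sorry-free
`Summit.Langlands.Langlands.Theorems.GaloisRepOfRegularAlgebraic.of_leaves_of_weilTraces`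
(`Theorems/IrreducibilityBySelfDualityGaloisRepOfRegularAlgebraicOfWeilTraces.lean`; stubs S3–S7 of the crux
line `Sketch`: Satake gap, gap transport, monodromy gap, inertia traces, local rigidity), whose first two
hypotheses are the Literature named facts `HarrisLanTaylorThorne2016.corollary627_splitOrUnramified` and
`ArthurClozel1989_strongLifting_archimedean` — definitionally (`Iff.rfl`) the first two antecedents here —
and whose last two hypotheses and conclusion are the remaining texts verbatim.

References: M. Harris, K.-W. Lan, R. Taylor, J. Thorne, Res. Math. Sci. 3:37 (2016), Cor. 6.27, Thm. 7.13
[HarrisLanTaylorThorneRMS2016]; J. Arthur, L. Clozel, Ann. of Math. Stud. 120 (1989), Ch. 3 Thms. 4.2, 5.1,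
Ch. 1 §7 [ArthurClozelAMS120]; I. Varma, Forum Math. Sigma 12 (2024) e21, Thm. 1 [VarmaFMS2024].
-/

noncomputable section

set_option linter.dupNamespace false -- project-wide option (lakefile weak.linter.dupNamespace); `Summit.Langlands.Langlands` is the mandated namespace

namespace Summit.Langlands.Langlands.Theorems

/-- **`GaloisRepOfRegularAlgebraicOfLeaves` holds, frame form** (item stmt-Langlands-15026 of route
`IrreducibilityBySelfDuality`): `HLTTCor627SplitOrUnramified → ACStrongLiftingArchimedean →
ACStrongCuspidalBaseChangePrime → VarmaWeilTracesUnramified → GaloisRepOfRegularAlgebraic`, all five route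
decl bodies written out verbatim so that this type `δ`-unfolds to the route decl
`Summit.Langlands.Langlands.Theses.IrreducibilityBySelfDuality.GaloisRepOfRegularAlgebraicOfLeaves` (and the
route file can import this module without a cycle).  Proof: the landed composition
`GaloisRepOfRegularAlgebraic.of_leaves_of_weilTraces` (HLTT Cor. 6.27 + Arthur–Clozel archimedean clause +
strong prime-degree cuspidal base change give HLTT Thm. A by `theoremA_existence_of_leaves'`; Varma's
Theorem 1 in trace form at `d ≠ 0`, the Satake gap of a cuspidal `π` and Grothendieck's monodromy theorem
give compatibility at every `v ∤ ℓ`).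
[cite: HarrisLanTaylorThorneRMS2016, Cor. 6.27 (p. 225), Thm. 7.13 (p. 232)]
[cite: ArthurClozelAMS120, Ch. 3 Thm. 4.2 (a), Thm. 5.1; Ch. 1 §7] [cite: VarmaFMS2024, Thm. 1] -/
theorem GaloisRepOfRegularAlgebraicOfLeaves_proof :
    -- antecedent `HLTTCor627SplitOrUnramified` (route decl body = item stmt-Langlands-15020, verbatim)
    (∀ {n : ℕ} {K : Type} [Field K] [NumberField K] (hcpt : Literature.NumberTheory.Automorphic.isCompact_glFiniteIntegralLevel n K) (p : ℕ) [Fact p.Prime], 1 < n → NumberField.IsCMField K → ∀ (F₀ : IntermediateField ℚ K), Module.finrank ℚ F₀ = 2 ∧ NumberField.IsTotallyComplex F₀ → NumberField.HasTwoPrimesOver F₀ p → ∀ (π : Literature.NumberTheory.Automorphic.CuspidalAutomorphicRepData n K hcpt), π.1.IsRegularAlgebraic → ∀ (ι : PadicAlgCl p ≃+* ℂ), ∃ (N₀ : ℕ) (R : ℕ → Literature.NumberTheory.GaloisRepresentations.FramedGaloisRep K (PadicAlgCl p) (2 * n)) (B : IsDedekindDomain.HeightOneSpectrum (NumberField.RingOfIntegers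 K) → Multiset (PadicAlgCl p)), (∀ N, N₀ ≤ N → (R N).toGaloisRep.IsSemisimple) ∧ (∀ v, Multiset.card (B v) = n ∧ (0 : PadicAlgCl p) ∉ B v) ∧ ∀ q : ℕ, q.Prime → q ≠ p → (NumberField.HasTwoPrimesOver F₀ q ∨ Algebra.IsUnramifiedIn (NumberField.RingOfIntegers K) (Ideal.span {(q : ℤ)})) → π.1.IsUnramifiedAbove q → ∀ v : IsDedekindDomain.HeightOneSpectrum (NumberField.RingOfIntegers K), ((q : ℕ) : NumberField.RingOfIntegers K) ∈ v.asIdeal → ∀ α : Multiset ℂ, π.1.HasSatakeParamAt v α → ∀ N, N₀ ≤ N → (R N).IsUnramifiedAt v ∧ (R N).HasFrobCharpolyAt v (Literature.NumberTheory.Automorphic.arithFrobPolyOfSatake ι v.residueCard n α * ((B v).map fun b => Polynomial.X - Polynomial.C (b * ((v.residueCard : PadicAlgCl p)⁻¹) ^ (2 * N))).prod)) →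
    -- antecedent `ACStrongLiftingArchimedean` (route decl body = item stmt-Langlands-15021, verbatim)
    (∀ (n : ℕ) (F E : Type) [Field F] [NumberField F] [Field E] [NumberField E] [Algebra F E] [IsGalois F E] (hF : Literature.NumberTheory.Automorphic.isCompact_glFiniteIntegralLevel n F) (hE : Literature.NumberTheory.Automorphic.isCompact_glFiniteIntegralLevel n E), IsCyclic (E ≃ₐ[F] E) → (Module.finrank F E).Prime → ∀ (π : Literature.NumberTheory.Automorphic.CuspidalAutomorphicRepData n F hF) (P : Literature.NumberTheory.Automorphic.CuspidalAutomorphicRepData n E hE), Literature.NumberTheory.Automorphic.IsWeakBaseChangeLiftAE π.1 P.1 → ∀ χ : (F →+* ℂ) → Multiset ℂ, π.1.HasArchParameter χ → P.1.HasArchParameter fun τ => χ (τ.comp (algebraMap F E))) →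
    -- antecedent `ACStrongCuspidalBaseChangePrime` (route decl body = item stmt-Langlands-15022, verbatim)
    (∀ (n : ℕ) (F E : Type) [Field F] [NumberField F] [Field E] [NumberField E] [Algebra F E] [IsGalois F E], (Module.finrank F E).Prime → ∀ (hF : Literature.NumberTheory.Automorphic.isCompact_glFiniteIntegralLevel n F) (π : Literature.NumberTheory.Automorphic.CuspidalAutomorphicRepData n F hF), (∃ v : IsDedekindDomain.HeightOneSpectrum (NumberField.RingOfIntegers F), ¬ Algebra.IsUnramifiedIn (NumberField.RingOfIntegers E) v.asIdeal ∧ π.1.IsUnramifiedAt v) → ∀ (hE : Literature.NumberTheory.Automorphic.isCompact_glFiniteIntegralLevel n E), ∃ P : Literature.NumberTheory.Automorphic.CuspidalAutomorphicRepData n E hE, ∀ (w : IsDedekindDomain.HeightOneSpectrum (NumberField.RingOfIntegers E)) (v : IsDedekindDomain.HeightOneSpectrum (NumberField.RingOfIntegers F)) (α : Multiset ℂ), w.asIdeal.under (NumberField.RingOfIntegers F) = v.asIdeal → Algebra.IsUnramifiedIn (NumberField.RingOfIntegers E) v.asIdeal → π.1.HasSatakeParamAt v α → P.1.HasSatakeParamAt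 w (α.map (· ^ w.asIdeal.inertiaDeg (NumberField.RingOfIntegers F)))) →
    -- antecedent `VarmaWeilTracesUnramified` (route decl body = item stmt-Langlands-15004, verbatim)
    (∀ {n : ℕ} {K : Type} [Field K] [NumberField K] (hcpt : Literature.NumberTheory.Automorphic.isCompact_glFiniteIntegralLevel n K), NumberField.IsTotallyReal K ∨ NumberField.IsCMField K → ∀ (π : Literature.NumberTheory.Automorphic.CuspidalAutomorphicRepData n K hcpt), π.1.IsRegularAlgebraic → ∀ (ℓ : ℕ) [Fact ℓ.Prime] (ι : PadicAlgCl ℓ ≃+* ℂ) (r : Literature.NumberTheory.GaloisRepresentations.FramedGaloisRep K (PadicAlgCl ℓ) n), r.toGaloisRep.IsSemisimple → Literature.NumberTheory.Automorphic.HarrisLanTaylorThorne2016.IsCompatible π.1 ι r → ∀ (v : IsDedekindDomain.HeightOneSpectrum (NumberField.RingOfIntegers K)), ((ℓ : ℕ) : NumberField.RingOfIntegers K) ∉ v.asIdeal → ∀ (α : Multiset ℂ), π.1.HasSatakeParamAt v α → ∀ (σ : Field.absoluteGaloisGroup (v.adicCompletion K)) (d : ℤ), d ≠ 0 → Literature.NumberTheory.GaloisRepresentations.IsFrobPow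 σ d → (((r.toLocal v) σ : Matrix.GeneralLinearGroup (Fin n) (PadicAlgCl ℓ)) : Matrix (Fin n) (Fin n) (PadicAlgCl ℓ)).trace = ((Literature.NumberTheory.Automorphic.arithFrobPolyOfSatake ι v.residueCard n α).roots.map fun b => b ^ d).sum) →
    -- conclusion `GaloisRepOfRegularAlgebraic` (route decl body = item stmt-Langlands-10785, verbatim)
    ∀ (n : ℕ) (K : Type) [Field K] [NumberField K] (hcpt : Literature.NumberTheory.Automorphic.isCompact_glFiniteIntegralLevel n K), (NumberField.IsTotallyReal K ∨ NumberField.IsCMField K) → ∀ (π : Literature.NumberTheory.Automorphic.CuspidalAutomorphicRepData n K hcpt), π.1.IsRegularAlgebraic → ∀ (ℓ : ℕ) [Fact ℓ.Prime] (ι : PadicAlgCl ℓ ≃+* ℂ), ∃ r : Literature.NumberTheory.GaloisRepresentations.FramedGaloisRep K (PadicAlgCl ℓ) n, r.toGaloisRep.IsSemisimple ∧ ∀ (v : IsDedekindDomain.HeightOneSpectrum (NumberField.RingOfIntegers K)) (α : Multiset ℂ), π.1.HasSatakeParamAt v α → ((ℓ : ℕ) : NumberField.RingOfIntegers K) ∉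 v.asIdeal → r.IsUnramifiedAt v ∧ r.HasFrobCharpolyAt v (Literature.NumberTheory.Automorphic.arithFrobPolyOfSatake ι v.residueCard n α) :=
  fun h627 harch hBC hV1 => GaloisRepOfRegularAlgebraic.of_leaves_of_weilTraces h627 harch hBC hV1

end Summit.Langlands.Langlands.Theorems

end
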